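import Literature.NumberTheory.Automorphic.AdelicPiSchwartzBruhatFourierInversion
import Mathlib.MeasureTheory.Integral.Prod
import Mathlib.MeasureTheory.Function.L2Space
import HarnessLib

/-!
# The Plancherel formula on the Schwartz–Bruhat space of `𝔸_K^ι`

Topic `NumberTheory/Automorphic`; namespace `Literature.NumberTheory.Automorphic`.  KERNEL ONLY: theorems; no
definition, no named fact, no `sorry`.  Sequel of `AdelicPiSchwartzBruhatFourierInversion.lean` (the inversion
formula `Φ̂̂(x) = ν(D^ι)² Φ(-x)` for `Φ ∈ 𝒮(𝔸_K^ι) = piSchwartzBruhat K ι`, `Φ̂ = adelicPiFourier K ι ν Φ`,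
`Φ̂(η) = ∫ Φ(v) ψ(Σ_i η_i v_i) dν(v)`, `ψ = adeleAddChar K` Tate's character, `D^ι = piFundamentalDomain K ι`) and the
adelic twin of `LocalPiSchwartzBruhatPlancherel.lean` (the same statements at one finite place).

For a number field `K`, a finite index type `ι` and ANY additive Haar measure `ν` on `𝔸_K^ι`:

* §1 **the multiplication formula** `integral_adelicPiFourier_mul_eq`: `∫ Φ̂ G dν = ∫ Φ Ĝ dν` for all INTEGRABLE
  `Φ, G` (Fubini for the kernel `(v, η) ↦ Φ(v) ψ(Σ η_i v_i) G(η)`, integrable on `𝔸_K^ι × 𝔸_K^ι` because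
  `|ψ| = 1`), with the integrability of `Φ̂ G` and `Φ Ĝ` (`integrable_adelicPiFourier_mul`,
  `integrable_mul_adelicPiFourier`);
* §2 **PARSEVAL / PLANCHEREL** `integral_adelicPiFourier_mul_conj_adelicPiFourier`:
  `∫ Φ̂ · conj Ψ̂ dν = ν(D^ι)² · ∫ Φ · conj Ψ dν` for `Φ` integrable and `Ψ ∈ 𝒮(𝔸_K^ι)` — §1 with `G = conj Ψ̂`
  (integrable), whose transform is `conj(Ψ̂̂(-·)) = ν(D^ι)² conj Ψ` by `conj ψ(t) = ψ(-t)` and inversion; for the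
  self-dual normalisation `ν(D^ι) = 1` this is `∫ Φ̂ conj Ψ̂ = ∫ Φ conj Ψ` (Tate's Theorem 4.1.2 ⇒ the Fourier
  transform is `L²`-isometric on `𝒮`, [CasselsFrohlichANT1967, Ch. XV Thm. 4.1.2]; [WeilBNT1967, Chap. VII §2,
  Cor. 1 of Thm. 2]);
* §3 consequences for `Φ ∈ 𝒮(𝔸_K^ι)`: `Φ · conj Φ` and `‖Φ‖²` are integrable (`integrable_mul_conj_of_mem_piSchwartzBruhat`,
  `integrable_norm_sq_of_mem_piSchwartzBruhat` — obtained from §1 itself, no boundedness argument), so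
  `𝒮(𝔸_K^ι) ⊆ L²(ν)` (`memLp_two_of_mem_piSchwartzBruhat_of_isAddHaarMeasure`), and the **`L²` form of PLANCHEREL**
  `lintegral_enorm_sq_adelicPiFourier`: `∫⁻ ‖Φ̂‖ₑ² dν = ν(D^ι)² · ∫⁻ ‖Φ‖ₑ² dν` (an identity in `ℝ≥0∞`), `= ∫⁻ ‖Φ‖ₑ²`
  when `ν(D^ι) = 1` (`lintegral_enorm_sq_adelicPiFourier_of_measure_eq_one`).

Use (GR lane of the Hodge/COR-CM cell, Track 2 of [GelbartRogawski1991, Prop. 3.1.1], ROADMAP (A2) "by generators"):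
the Weyl element of `Sp(W_𝔸)` is implemented on `𝒮(𝔸_F^n)` by `Φ ↦ Φ̂(-·)` for the self-dual measure
(`Weil1964/AdelicThetaWeylElement`, `AdelicMetaplecticGenerators.weylPair`); §3 says this operator is `L²`-ISOMETRIC,
the input for "every LF-continuous metaplectic operator is `L²`-isometric up to a positive scalar"
(`Weil1964/AdelicMetaplecticGenerated.adelicMpCont.induction_on_generators`).  Nothing is cited as a hypothesis.

## References
* [CasselsFrohlichANT1967] J. Tate, *Fourier analysis in number fields and Hecke's zeta-functions*, in Cassels–Fröhlich
  (eds.), *Algebraic Number Theory* (1967), Ch. XV, Thm. 4.1.2, Thm. 4.1.3 (2).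
* [WeilBNT1967] A. Weil, *Basic Number Theory* (1967), Chap. VII §2, Thm. 2 and Cor. 1.
* [Weil1964] A. Weil, Acta Math. 111 (1964), Chap. I n° 11, n° 13.
-/

set_option autoImplicit false

noncomputable section

open MeasureTheory MeasureTheory.Measure NumberField IsDedekindDomain Function
open scoped ENNReal NNReal ComplexConjugate

namespace Literature.NumberTheory.Automorphic

variable {K : Type} [Field K] [NumberField K] {ι : Type} [Fintype ι]
  [MeasurableSpace (AdeleRing (𝓞 K) K)] [BorelSpace (AdeleRing (𝓞 K) K)]
  (ν : Measure (ι → AdeleRing (𝓞 K) K)) [ν.IsAddHaarMeasure]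

/-! ## §0 The character: `|ψ| = 1`, `conj ψ(t) = ψ(-t)`, continuity of the kernel -/

omit [Fintype ι] [MeasurableSpace (AdeleRing (𝓞 K) K)] [BorelSpace (AdeleRing (𝓞 K) K)] in
/-- `conj ψ(t) = ψ(-t)` for Tate's character (a unitary character). [folklore] -/
private theorem conj_coe_adeleAddChar (t : AdeleRing (𝓞 K) K) :
    conj ((adeleAddChar K t : Circle) : ℂ) = ((adeleAddChar K (-t) : Circle) : ℂ) := by
  rw [AddChar.map_neg_eq_inv, Circle.coe_inv_eq_conj]

omit [MeasurableSpace (AdeleRing (𝓞 K) K)] [BorelSpace (AdeleRing (𝓞 K) K)] in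
/-- the Fourier kernel `(v, η) ↦ ψ(Σ_i η_i v_i)` is continuous on `𝔸_K^ι × 𝔸_K^ι`. [folklore] -/
private theorem continuous_adeleAddChar_sum_mul_prod :
    Continuous fun p : (ι → AdeleRing (𝓞 K) K) × (ι → AdeleRing (𝓞 K) K) =>
      ((adeleAddChar K (∑ i, p.2 i * p.1 i) : Circle) : ℂ) :=
  continuous_subtype_val.comp ((continuous_adeleAddChar K).comp
    (continuous_finsetSum _ fun i _ =>
      ((continuous_apply i).comp continuous_snd).mul ((continuous_apply i).comp continuous_fst)))

omit [Fintype ι] [MeasurableSpace (AdeleRing (𝓞 K) K)] [BorelSpace (AdeleRing (𝓞 K) K)] in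
/-- `Σ_i η_i v_i = Σ_i v_i η_i`. [folklore] -/
private theorem sum_mul_comm_adeleRing [Fintype ι] (v η : ι → AdeleRing (𝓞 K) K) :
    ∑ i, η i * v i = ∑ i, v i * η i :=
  Finset.sum_congr rfl fun _ _ => mul_comm _ _

omit [Fintype ι] [BorelSpace (AdeleRing (𝓞 K) K)] [ν.IsAddHaarMeasure] in
/-- complex conjugation preserves integrability. [folklore] -/
private theorem integrable_conj_of_integrable {f : (ι → AdeleRing (𝓞 K) K) → ℂ} (hf : Integrable f ν) :
    Integrable (fun v => conj (f v)) ν := by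
  simpa using Complex.conjCLE.toContinuousLinearMap.integrable_comp hf

/-! ## §1 Fubini: the multiplication formula `∫ Φ̂ G = ∫ Φ Ĝ` -/

omit [ν.IsAddHaarMeasure] in
/-- the kernel `(v, η) ↦ Φ(v) ψ(Σ_i η_i v_i) G(η)` is integrable on `𝔸_K^ι × 𝔸_K^ι` for integrable `Φ, G`
(`|ψ| = 1`, Tonelli; `ν` any s-finite measure). [cite: WeilBNT1967, Chap. VII §2, Thm. 2] -/
theorem integrable_adelicFourierKernel [SFinite ν] {Φ G : (ι → AdeleRing (𝓞 K) K) → ℂ} (hΦ : Integrable Φ ν)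
    (hG : Integrable G ν) :
    Integrable (fun p : (ι → AdeleRing (𝓞 K) K) × (ι → AdeleRing (𝓞 K) K) =>
      Φ p.1 * ((adeleAddChar K (∑ i, p.2 i * p.1 i) : Circle) : ℂ) * G p.2) (ν.prod ν) := by
  haveI := secondCountableTopology_adeleRing K
  haveI := locallyCompactSpace_adeleRing' K
  haveI := t2Space_adeleRing K
  have h1 : Integrable (fun p : (ι → AdeleRing (𝓞 K) K) × (ι → AdeleRing (𝓞 K) K) => Φ p.1 * G p.2)
      (ν.prod ν) := hΦ.mul_prod hG
  have h2 : Integrable (fun p : (ι → AdeleRing (𝓞 K) K) × (ι → AdeleRing (𝓞 K) K) =>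
      ((adeleAddChar K (∑ i, p.2 i * p.1 i) : Circle) : ℂ) * (Φ p.1 * G p.2)) (ν.prod ν) :=
    h1.bdd_mul (continuous_adeleAddChar_sum_mul_prod (K := K) (ι := ι)).aestronglyMeasurable
      (ae_of_all _ fun p => (Circle.norm_coe _).le)
  refine h2.congr (ae_of_all _ fun p => ?_)
  simp only
  ring

/-- **Fubini, first order**: `η ↦ ∫_v Φ(v) ψ(Σ η_i v_i) G(η) dν(v) = Φ̂(η) G(η)` is integrable, i.e. `Φ̂ · G` is
integrable for integrable `Φ, G`. [cite: WeilBNT1967, Chap. VII §2, Thm. 2] -/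
theorem integrable_adelicPiFourier_mul {Φ G : (ι → AdeleRing (𝓞 K) K) → ℂ} (hΦ : Integrable Φ ν)
    (hG : Integrable G ν) :
    Integrable (fun η => adelicPiFourier K ι ν Φ η * G η) ν := by
  haveI := secondCountableTopology_adeleRing K
  haveI := locallyCompactSpace_adeleRing' K
  haveI := t2Space_adeleRing K
  have h := (integrable_adelicFourierKernel ν hΦ hG).integral_prod_right
  refine h.congr (ae_of_all _ fun η => ?_)
  simp only
  rw [adelicPiFourier_apply, ← integral_mul_const]

/-- **Fubini, second order**: `v ↦ ∫_η Φ(v) ψ(Σ η_i v_i) G(η) dν(η) = Φ(v) Ĝ(v)` is integrable, i.e. `Φ · Ĝ` is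
integrable for integrable `Φ, G`. [cite: WeilBNT1967, Chap. VII §2, Thm. 2] -/
theorem integrable_mul_adelicPiFourier {Φ G : (ι → AdeleRing (𝓞 K) K) → ℂ} (hΦ : Integrable Φ ν)
    (hG : Integrable G ν) :
    Integrable (fun v => Φ v * adelicPiFourier K ι ν G v) ν := by
  haveI := secondCountableTopology_adeleRing K
  haveI := locallyCompactSpace_adeleRing' K
  haveI := t2Space_adeleRing K
  have h := (integrable_adelicFourierKernel ν hΦ hG).integral_prod_left
  refine h.congr (ae_of_all _ fun v => ?_)
  simp only
  rw [adelicPiFourier_apply, ← integral_const_mul]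
  refine integral_congr_ae (ae_of_all _ fun η => ?_)
  simp only
  rw [sum_mul_comm_adeleRing η v]
  ring

/-- **THE MULTIPLICATION FORMULA** `∫ Φ̂(η) G(η) dν(η) = ∫ Φ(v) Ĝ(v) dν(v)` for integrable `Φ, G` on `𝔸_K^ι`
(both orders of integration of the integrable kernel `Φ(v) ψ(Σ η_i v_i) G(η)`; the pairing `Σ_i η_i v_i` is
symmetric). [cite: WeilBNT1967, Chap. VII §2, Thm. 2] -/
theorem integral_adelicPiFourier_mul_eq {Φ G : (ι → AdeleRing (𝓞 K) K) → ℂ} (hΦ : Integrable Φ ν)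
    (hG : Integrable G ν) :
    ∫ η, adelicPiFourier K ι ν Φ η * G η ∂ν = ∫ v, Φ v * adelicPiFourier K ι ν G v ∂ν := by
  haveI := secondCountableTopology_adeleRing K
  haveI := locallyCompactSpace_adeleRing' K
  haveI := t2Space_adeleRing K
  have hker := integrable_adelicFourierKernel ν hΦ hG
  have hswap := integral_integral_swap (f := fun (v η : ι → AdeleRing (𝓞 K) K) =>
    Φ v * ((adeleAddChar K (∑ i, η i * v i) : Circle) : ℂ) * G η) hker
  calc ∫ η, adelicPiFourier K ι ν Φ η * G η ∂ν
      = ∫ η, ∫ v, Φ v * ((adeleAddChar K (∑ i, η i * v i) : Circle) : ℂ) * G η ∂ν ∂ν := by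
        refine integral_congr_ae (ae_of_all _ fun η => ?_)
        simp only
        rw [adelicPiFourier_apply, ← integral_mul_const]
    _ = ∫ v, ∫ η, Φ v * ((adeleAddChar K (∑ i, η i * v i) : Circle) : ℂ) * G η ∂ν ∂ν := hswap.symm
    _ = ∫ v, Φ v * adelicPiFourier K ι ν G v ∂ν := by
        refine integral_congr_ae (ae_of_all _ fun v => ?_)
        simp only
        rw [adelicPiFourier_apply, ← integral_const_mul]
        refine integral_congr_ae (ae_of_all _ fun η => ?_)
        simp only
        rw [sum_mul_comm_adeleRing η v]
        ring

/-! ## §2 Parseval / Plancherel: `∫ Φ̂ conj Ψ̂ = ν(D^ι)² ∫ Φ conj Ψ` -/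

omit [BorelSpace (AdeleRing (𝓞 K) K)] [ν.IsAddHaarMeasure] in
/-- the transform of `conj G` is `conj(Ĝ(-·))`: `∫ conj G(η) ψ(Σ v_i η_i) dν(η) = conj (Ĝ(-v))`.
[cite: WeilBNT1967, Chap. VII §2, Thm. 2] -/
theorem adelicPiFourier_conj (G : (ι → AdeleRing (𝓞 K) K) → ℂ) (v : ι → AdeleRing (𝓞 K) K) :
    adelicPiFourier K ι ν (fun η => conj (G η)) v = conj (adelicPiFourier K ι ν G (-v)) := by
  rw [adelicPiFourier_apply, adelicPiFourier_apply, ← integral_conj]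
  refine integral_congr_ae (ae_of_all _ fun η => ?_)
  simp only [map_mul, conj_coe_adeleAddChar, Pi.neg_apply, neg_mul, Finset.sum_neg_distrib, neg_neg]

/-- **PARSEVAL'S FORMULA on `𝒮(𝔸_K^ι)`**: `∫ Φ̂ · conj Ψ̂ dν = ν(D^ι)² · ∫ Φ · conj Ψ dν` for `Φ` integrable and
`Ψ ∈ 𝒮(𝔸_K^ι)` — the multiplication formula against `G = conj Ψ̂`, whose transform is
`conj(Ψ̂̂(-v)) = ν(D^ι)² conj Ψ(v)` by Fourier inversion.  For the self-dual measure (`ν(D^ι) = 1`) the constant is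
`1`. [cite: CasselsFrohlichANT1967, Ch. XV (Tate), Thm. 4.1.2] [cite: WeilBNT1967, Chap. VII §2, Cor. 1] -/
theorem integral_adelicPiFourier_mul_conj_adelicPiFourier {Φ Ψ : (ι → AdeleRing (𝓞 K) K) → ℂ}
    (hΦ : Integrable Φ ν) (hΨ : Ψ ∈ piSchwartzBruhat K ι) :
    ∫ η, adelicPiFourier K ι ν Φ η * conj (adelicPiFourier K ι ν Ψ η) ∂ν =
      (((ν (piFundamentalDomain K ι)).toReal ^ 2 : ℝ) : ℂ) * ∫ v, Φ v * conj (Ψ v) ∂ν := by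
  have hG : Integrable (fun η => conj (adelicPiFourier K ι ν Ψ η)) ν :=
    integrable_conj_of_integrable ν (integrable_of_mem_piSchwartzBruhat (adelicPiFourier_mem_piSchwartzBruhat hΨ))
  rw [integral_adelicPiFourier_mul_eq ν hΦ hG, ← integral_const_mul]
  refine integral_congr_ae (ae_of_all _ fun v => ?_)
  simp only
  rw [adelicPiFourier_conj, adelicPiFourier_adelicPiFourier ν hΨ, neg_neg, map_mul, Complex.conj_ofReal]
  ring

/-- **PARSEVAL for the self-dual measure**: `ν(D^ι) = 1 ⇒ ∫ Φ̂ · conj Ψ̂ dν = ∫ Φ · conj Ψ dν` (`Φ` integrable,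
`Ψ ∈ 𝒮(𝔸_K^ι)`). [cite: CasselsFrohlichANT1967, Ch. XV (Tate), Thm. 4.1.2] -/
theorem integral_adelicPiFourier_mul_conj_adelicPiFourier_of_measure_eq_one {Φ Ψ : (ι → AdeleRing (𝓞 K) K) → ℂ}
    (hΦ : Integrable Φ ν) (hΨ : Ψ ∈ piSchwartzBruhat K ι) (hν : ν (piFundamentalDomain K ι) = 1) :
    ∫ η, adelicPiFourier K ι ν Φ η * conj (adelicPiFourier K ι ν Ψ η) ∂ν = ∫ v, Φ v * conj (Ψ v) ∂ν := by
  rw [integral_adelicPiFourier_mul_conj_adelicPiFourier ν hΦ hΨ, hν, ENNReal.toReal_one, one_pow,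
    Complex.ofReal_one, one_mul]

/-! ## §3 `𝒮(𝔸_K^ι) ⊆ L²(ν)` and Plancherel for the `L²` norm -/

/-- for `Φ ∈ 𝒮(𝔸_K^ι)` the function `Φ · conj Φ` is integrable — from the multiplication formula: it is
`ν(D^ι)⁻² · Φ · (conj Φ̂)̂`, and `Φ · Ĝ` is integrable for every integrable `G` ([Weil1964, Chap. I n° 11]:
the standard functions lie in `L²(X)`). [cite: Weil1964, Chap. I n° 11] -/
theorem integrable_mul_conj_of_mem_piSchwartzBruhat {Φ : (ι → AdeleRing (𝓞 K) K) → ℂ}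
    (hΦ : Φ ∈ piSchwartzBruhat K ι) : Integrable (fun v => Φ v * conj (Φ v)) ν := by
  have hΦi : Integrable Φ ν := integrable_of_mem_piSchwartzBruhat hΦ
  have hG : Integrable (fun η => conj (adelicPiFourier K ι ν Φ η)) ν :=
    integrable_conj_of_integrable ν (integrable_of_mem_piSchwartzBruhat (adelicPiFourier_mem_piSchwartzBruhat hΦ))
  set c : ℝ := (ν (piFundamentalDomain K ι)).toReal ^ 2 with hc_def
  have hc0 : (c : ℂ) ≠ 0 :=
    Complex.ofReal_ne_zero.2 (pow_ne_zero 2 (Weil1964.measure_piFundamentalDomain_toReal_pos (ν := ν)).ne')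
  have h := (integrable_mul_adelicPiFourier ν hΦi hG).const_mul ((c : ℂ)⁻¹)
  refine h.congr (ae_of_all _ fun v => ?_)
  simp only
  rw [adelicPiFourier_conj, adelicPiFourier_adelicPiFourier ν hΦ, neg_neg, map_mul, Complex.conj_ofReal,
    ← hc_def, ← mul_assoc, ← mul_assoc, mul_comm ((c : ℂ)⁻¹), mul_assoc (Φ v), inv_mul_cancel₀ hc0, mul_one]

/-- for `Φ ∈ 𝒮(𝔸_K^ι)`, `‖Φ‖²` is integrable for every Haar measure (`𝒮(X) ⊆ L²(X)`).
[cite: Weil1964, Chap. I n° 11] -/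
theorem integrable_norm_sq_of_mem_piSchwartzBruhat {Φ : (ι → AdeleRing (𝓞 K) K) → ℂ}
    (hΦ : Φ ∈ piSchwartzBruhat K ι) : Integrable (fun v => ‖Φ v‖ ^ 2) ν := by
  have h := (integrable_mul_conj_of_mem_piSchwartzBruhat ν hΦ).norm
  refine h.congr (ae_of_all _ fun v => ?_)
  simp only
  rw [norm_mul, Complex.norm_conj, sq]

/-- **`𝒮(𝔸_K^ι) ⊆ L²(𝔸_K^ι, ν)`** for every additive Haar measure `ν` (name kept distinct from the tensor-based
`Weil1964.memLp_two_of_mem_piSchwartzBruhat` of the GR-1 lane). [cite: Weil1964, Chap. I n° 11] -/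
theorem memLp_two_of_mem_piSchwartzBruhat_of_isAddHaarMeasure {Φ : (ι → AdeleRing (𝓞 K) K) → ℂ}
    (hΦ : Φ ∈ piSchwartzBruhat K ι) : MemLp Φ 2 ν :=
  (memLp_two_iff_integrable_sq_norm (integrable_of_mem_piSchwartzBruhat hΦ (ν := ν)).aestronglyMeasurable).2
    (integrable_norm_sq_of_mem_piSchwartzBruhat ν hΦ)

omit [Fintype ι] [BorelSpace (AdeleRing (𝓞 K) K)] [ν.IsAddHaarMeasure] in
/-- `∫ Φ conj Φ dν = ∫⁻ ‖Φ‖ₑ² dν` (a real number cast to `ℂ`) as soon as `‖Φ‖²` is integrable. [folklore] -/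
private theorem integral_mul_conj_eq_lintegral_of_integrable_norm_sq {Φ : (ι → AdeleRing (𝓞 K) K) → ℂ}
    (hint : Integrable (fun v => ‖Φ v‖ ^ 2) ν) :
    ∫ v, Φ v * conj (Φ v) ∂ν = ((∫⁻ v, ‖Φ v‖ₑ ^ 2 ∂ν).toReal : ℂ) := by
  have h1 : (fun v => Φ v * conj (Φ v)) = fun v => ((‖Φ v‖ ^ 2 : ℝ) : ℂ) := by
    funext v
    rw [Complex.mul_conj, Complex.normSq_eq_norm_sq]
  rw [h1, integral_complex_ofReal]
  congr 1
  rw [integral_eq_lintegral_of_nonneg_ae (ae_of_all _ fun v => sq_nonneg _) hint.aestronglyMeasurable]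
  congr 1
  refine lintegral_congr fun v => ?_
  rw [← ofReal_norm, ENNReal.ofReal_pow (norm_nonneg _)]

/-- `∫⁻ ‖Φ‖ₑ² dν < ∞` for `Φ ∈ 𝒮(𝔸_K^ι)` (`𝒮(X) ⊆ L²(X)`). [cite: Weil1964, Chap. I n° 11] -/
theorem lintegral_enorm_sq_lt_top_of_mem_piSchwartzBruhat {Φ : (ι → AdeleRing (𝓞 K) K) → ℂ}
    (hΦ : Φ ∈ piSchwartzBruhat K ι) : ∫⁻ v, ‖Φ v‖ₑ ^ 2 ∂ν < ∞ := by
  have h := (integrable_norm_sq_of_mem_piSchwartzBruhat ν hΦ).hasFiniteIntegral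
  rw [hasFiniteIntegral_iff_enorm] at h
  refine lt_of_le_of_lt (le_of_eq (lintegral_congr fun v => ?_)) h
  rw [← ofReal_norm, ← ENNReal.ofReal_pow (norm_nonneg _), Real.enorm_eq_ofReal (sq_nonneg _)]

/-- **PLANCHEREL, `L²` form**: `∫⁻ ‖Φ̂‖ₑ² dν = ν(D^ι)² · ∫⁻ ‖Φ‖ₑ² dν` for `Φ ∈ 𝒮(𝔸_K^ι)` and every additive Haar
measure `ν` on `𝔸_K^ι` (an identity of extended non-negative reals; both sides are finite).
[cite: CasselsFrohlichANT1967, Ch. XV (Tate), Thm. 4.1.2] [cite: WeilBNT1967, Chap. VII §2, Cor. 1] -/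
theorem lintegral_enorm_sq_adelicPiFourier {Φ : (ι → AdeleRing (𝓞 K) K) → ℂ} (hΦ : Φ ∈ piSchwartzBruhat K ι) :
    ∫⁻ η, ‖adelicPiFourier K ι ν Φ η‖ₑ ^ 2 ∂ν =
      ν (piFundamentalDomain K ι) ^ 2 * ∫⁻ v, ‖Φ v‖ₑ ^ 2 ∂ν := by
  have hΨ : adelicPiFourier K ι ν Φ ∈ piSchwartzBruhat K ι := adelicPiFourier_mem_piSchwartzBruhat hΦ
  have h := integral_adelicPiFourier_mul_conj_adelicPiFourier ν (integrable_of_mem_piSchwartzBruhat hΦ) hΦ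
  rw [integral_mul_conj_eq_lintegral_of_integrable_norm_sq ν (integrable_norm_sq_of_mem_piSchwartzBruhat ν hΨ),
    integral_mul_conj_eq_lintegral_of_integrable_norm_sq ν (integrable_norm_sq_of_mem_piSchwartzBruhat ν hΦ),
    ← Complex.ofReal_mul, Complex.ofReal_inj] at h
  have hfin : ν (piFundamentalDomain K ι) ≠ ∞ :=
    ((measure_mono subset_closure).trans_lt (isCompact_closure_piFundamentalDomain K ι).measure_lt_top).ne
  have hc : 0 ≤ (ν (piFundamentalDomain K ι)).toReal ^ 2 := sq_nonneg _
  rw [← ENNReal.ofReal_toReal (lintegral_enorm_sq_lt_top_of_mem_piSchwartzBruhat ν hΨ).ne,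
    ← ENNReal.ofReal_toReal (lintegral_enorm_sq_lt_top_of_mem_piSchwartzBruhat ν hΦ).ne, h,
    ENNReal.ofReal_mul hc, ← ENNReal.toReal_pow, ENNReal.ofReal_toReal (ENNReal.pow_ne_top hfin)]

/-- **PLANCHEREL for the self-dual measure**: `ν(D^ι) = 1 ⇒ ∫⁻ ‖Φ̂‖ₑ² dν = ∫⁻ ‖Φ‖ₑ² dν` for `Φ ∈ 𝒮(𝔸_K^ι)` — the
Fourier transform of `𝒮(𝔸_K^ι)` is an `L²`-ISOMETRY (Tate's Theorem 4.1.2; [Weil1964, Chap. I n° 11]: the operator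
of the Weyl element on the Schrödinger model is unitary). [cite: CasselsFrohlichANT1967, Ch. XV (Tate), Thm. 4.1.2] -/
theorem lintegral_enorm_sq_adelicPiFourier_of_measure_eq_one {Φ : (ι → AdeleRing (𝓞 K) K) → ℂ}
    (hΦ : Φ ∈ piSchwartzBruhat K ι) (hν : ν (piFundamentalDomain K ι) = 1) :
    ∫⁻ η, ‖adelicPiFourier K ι ν Φ η‖ₑ ^ 2 ∂ν = ∫⁻ v, ‖Φ v‖ₑ ^ 2 ∂ν := by
  rw [lintegral_enorm_sq_adelicPiFourier ν hΦ, hν, one_pow, one_mul]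

end Literature.NumberTheory.Automorphic

end
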